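import Summits.BirchSwinnertonDyer.BirchSwinnertonDyer.Theorems.ErratumRoadFiveRegCertRung8085y1Split
import Summits.BirchSwinnertonDyer.BirchSwinnertonDyer.Theorems.ErratumRoadFiveEulerHalfNotRamOfExceptionalZeroRoad
import HarnessLib

/-!
# Route `ErratumRoadFive`, crux `EulerHalfNotRamNoInertSetAtFive` (item 19715) — the registered BC5 rung
# `stub_rung_res_8085y1` from PUBLISHED NAMED FACTS ALONE: the exz-road supplier
# `ExceptionalZeroRoad.stub_rung_res_8085y1_of_split_of_certSplit` (p548212) with its two per-pair inputs — `5` split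
# for 8085y1 and ONE split REGMULT row `RegMult.CertSplit E 5 Q 1` — DISCHARGED in the kernel (file
# `ErratumRoadFiveRegCertRung8085y1Split`, first-order split row checker of seat tam3-p2)

HONEST FRAMING (cell `bsd-stepL`, seat `bsd-stepL-tam3-p2` g4; `--supports stmt-BirchSwinnertonDyer-19715 --as helper`): ONE
curve; THEOREMS ONLY, 0 definitions, 0 named facts, 0 sorry. The rung is CONDITIONAL on six PUBLISHED named facts taken
as hypotheses BY NAME (Kato's divisibility in the surjective multiplicative shape, Stein–Wuthrich Thm. 6.1 split,
existence of THE split-canonical height, Disegni 2020 Thm. 1, GZK, modularity-as-parametrisation) — exactly the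
class-level inputs of p548212; what is removed here is every PER-PAIR input (the census bit «5 split» and the REGMULT
row are now kernel theorems). This answers the cell's DATA ASK D-f «FIRST ROW WANTED = (8085y1, 5)» and the first
conjunct's companion of RULING 34's re-trigger in kernel currency; it closes nothing by itself (the crux 19715 is a
∀-statement; this is its BC5 rung), and BSD is not proved by any of this.

* `stub_rung_res_8085y1_of_publishedFacts` — the registered stub text VERBATIM as conclusion, hypotheses = the six
  named facts.

References: [Disegni2020] Thm. 1 (§1.2); [SteinWuthrich2013] Thm. 6.1, §4.2 (p. 16); [Wuthrich2014] Thm. 3;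
[KolyvaginEulerSystems1990] Thm. A; [BCDTJAMS2001] Thm. A; [Cremona1997] Table 1 (curve 8085y1).
-/

noncomputable section

open scoped Classical
open WeierstrassCurve Literature.NumberTheory.EllipticCurves
open Literature.NumberTheory.EllipticCurves.SteinWuthrich2013
open Literature.NumberTheory.EllipticCurves.Rank1Residual
open Literature.NumberTheory.EllipticCurves.ModularForms
open Literature.NumberTheory.EllipticCurves.Rank1Residual.Typed
open Literature.NumberTheory.EllipticCurves.Wuthrich2014
open Summit.BirchSwinnertonDyer.Rank1Residual Summit.BirchSwinnertonDyer.Rank1Residual.X11b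
open Summit.BirchSwinnertonDyer.BirchSwinnertonDyer.Theorems

namespace Summit.BirchSwinnertonDyer.Rank1Residual.X11b.RegMult.Rung8085y1

/-- **`stub_rung_res_8085y1` of crux 19715 from published named facts alone** (the registered stub text verbatim as
the conclusion): `ExceptionalZeroRoad.stub_rung_res_8085y1_of_split_of_certSplit` (p548212) fed with the kernel
theorems `Rung8085y1.split_five` (node-tangent root `t = 2` mod `5`) and `Rung8085y1.certSplit_Q` (first-order split
row certificate: `5² ∥ a⁴ − 1`, `5 ∥ U⁴ − c₄²⁴`, `2 + 1 ≠ 4`). CONDITIONAL on the six named facts; ONE curve.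
[cite: Disegni2020, Thm. 1 (§1.2)] [cite: SteinWuthrich2013, Thm. 6.1, §4.2] [cite: Wuthrich2014, Thm. 3]
[cite: KolyvaginEulerSystems1990, Thm. A] [cite: Cremona1997, Table 1 (curve 8085y1)] -/
theorem stub_rung_res_8085y1_of_publishedFacts
    (hKato : kato_charIdeal_dvd_multiplicative_of_surjective) (hJs : thm61_splitMultiplicative)
    (hHs : exists_isSplitMultCanonical) (hDf : Disegni2020.thm1_padicBSD_rankOne_multiplicative)
    (hGZK : rank_eq_analyticRank_of_analyticRank_le_one) (hpar : nonempty_modularParametrizationData)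
    [((⟨0, 1, 1, -6435, -644416⟩ : WeierstrassCurve ℤ).baseChange ℚ).IsElliptic] [((⟨0, 1, 1, -6435, -644416⟩ : WeierstrassCurve ℤ).baseChange ℚ).IsGloballyMinimal] [Fact (Nat.Prime 5)] :
    ClassX11b ((⟨0, 1, 1, -6435, -644416⟩ : WeierstrassCurve ℤ).baseChange ℚ) 5 → 5 ≤ 5 → Surj ((⟨0, 1, 1, -6435, -644416⟩ : WeierstrassCurve ℤ).baseChange ℚ) 5 → ¬ Ram ((⟨0, 1, 1, -6435, -644416⟩ : WeierstrassCurve ℤ).baseChange ℚ) 5 → 5 ∣ ((⟨0, 1, 1, -6435, -644416⟩ : WeierstrassCurve ℤ).baseChange ℚ).tamagawaProduct →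
      (∃ ℓ : ℕ, ∃ _ : Fact ℓ.Prime, ℓ ≠ 5 ∧ ((⟨0, 1, 1, -6435, -644416⟩ : WeierstrassCurve ℤ).baseChange ℚ).HasMultiplicativeReductionAtPrime ℓ) →
        ¬ (∃ S : Finset ℕ, (∀ ℓ ∈ S, ∃ _ : Fact ℓ.Prime, Mult ((⟨0, 1, 1, -6435, -644416⟩ : WeierstrassCurve ℤ).baseChange ℚ) ℓ) ∧ Even S.card ∧ 5 ∈ S ∧
            (∀ (ℓ : ℕ) [Fact ℓ.Prime], ℓ ∉ S → ((⟨0, 1, 1, -6435, -644416⟩ : WeierstrassCurve ℤ).baseChange ℚ).HasSplitMultiplicativeReductionAtPrime ℓ →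
              ¬ 5 ∣ padicValInt ℓ ((⟨0, 1, 1, -6435, -644416⟩ : WeierstrassCurve ℤ).baseChange ℚ).minimalDiscriminantInt) ∧
            (¬ 5 ∣ padicValInt 5 ((⟨0, 1, 1, -6435, -644416⟩ : WeierstrassCurve ℤ).baseChange ℚ).minimalDiscriminantInt ∨
              ∃ R ⊆ S, S.card = 2 * R.card ∧ ∀ q ∈ R, q ≠ 2 ∧ ¬ 5 ∣ q - 1)) →
          Typed.MissingUpperBoundAt ((⟨0, 1, 1, -6435, -644416⟩ : WeierstrassCurve ℤ).baseChange ℚ) 5 :=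
  ExceptionalZeroRoad.stub_rung_res_8085y1_of_split_of_certSplit hKato hJs hHs hDf hGZK hpar split_five certSplit_Q

end Summit.BirchSwinnertonDyer.Rank1Residual.X11b.RegMult.Rung8085y1

end
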